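import Summits.ABC.IUTFork.Repair.CandMochizuki4
import Summits.ABC.IUTFork.Repair.CandMochizuki6
import Summits.ABC.IUTFork.Cor312PinnedFrameFlip
import HarnessLib

/-!
# IUT REPAIR branch (rung LADDER-ABC:A2.RP), class (ii) — TESTS for rows RP-M04b / RP-M36a–d: the FRAME locus (abc-iut-w4-d103's
# `flipSetting`) and the FAITHFUL saturation «smallest λ·𝒪 containing» = the holomorphic hull itself

Proof-only companion (REPAIR-SPEC §2 «`Cand<Class><k>Tests` = T-b/T-c, same k») of this seat's `CandMochizuki4` (p427897) and
`CandMochizuki6` (p428116); seat abc-iut-rp-m2. TAKES NO SIDE; nothing asserted; no new hypothesis (`frameSat` below is DATA: a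
saturation operator built from the setting's own hull frame). Answers the lead's RULINGS #7 (1) (T-c vector: name the INFLATION LOCUS of
every SAT+ witness) with a SECOND locus for the hull/volume-level rows, and sharpens RP-M36a.

SOURCE of the saturation read as the hull: [IUTchIII] Rmk. 3.9.5 (i), kurims `paper:url-4b091feeb646` p. 127 («the holomorphic hull of
U … the smallest subset of the form λ·𝒪_{(−)} that contains U»); Rmk. 3.12.2 (v) p. 194 l. 22–31 («an indeterminacy with respect to
"O^×"-multiples … holomorphic hulls, i.e., which have the effect of absorbing this indeterminacy»). [claim: Mochizuki2012, status: disputed]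

RESULTS (kernel):
* `H_frameSat` — with the FAITHFUL saturation `frameSat P` («pass to the smallest hull-set containing the region» = the setting's holomorphic
  hull), RP-M36a's mechanism clause `CandMochizuki6.H` (Extensive ∧ HullAbsorbs) holds in EVERY setting (extensivity and monotonicity of the
  hull): the absorption mechanism of Rmk. 3.12.2 (v) is a THEOREM of the frame axioms, hence INSUFFICIENT by itself wherever it is read;
* SAT+[frame] witnesses at abc-iut-w4-d103's `flipSetting p` (PR-2's countermodel with ONLY the hull frame coarsened; honest `j²`-volumes,
  honest q-datum, pins, typed Thm. 3.11, bridge hypotheses, `|log(q)| > 0`; `GapA3` FALSE, Licence/GapH3/Statement TRUE): RP-M04b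
  (`CandMochizuki4.H'`), RP-M36b (`CandMochizuki6.H' frameSat`), RP-M36c (`H''`, READING 0), RP-M36d (`H'''`) all HOLD there
  (`frame_locus_witnesses`) — second T-c locus «frame» beside the «ρ/(Ind3)» locus (one-ρ log-shell `d = 3`) recorded in the row lines.
Typed ≠ proved; instantiated ≠ endorsed; standard axioms only.
-/

noncomputable section

open Set

namespace Summit.ABC.IUTFork.Repair.CandMochizuki6Tests

open Thm311 Cor312 Cor312Vol Literature.IUT.LogThetaLattice

variable {T : ThetaIndex} (S : LatticeSituation T) (P : Cor312.Setting S.toSituation)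
  (ρ : (∀ v : T.V, v ∈ T.Vbad → Set (S.L.StarPacket v)) → ∀ (j : T.Label) (vQ : T.VQ), Set (S.L.Packet j vQ))
  (qK : ∀ v : T.V, v ∈ T.Vbad → Set (S.L.StarPacket v))

/-! ## 1. The faithful saturation: the holomorphic hull of the setting's own frame -/

/-- **`frameSat`** — the saturation «smallest `λ·𝒪` containing the region» (Rmk. 3.9.5 (i)): the holomorphic hull operator of the setting's
hull frame at each packet. DATA (built from `P.frame`); the faithful instance of `CandMochizuki6.Saturation` for Rmk. 3.12.2 (v)'s
«O^×-indeterminacy absorbed by holomorphic hulls». [claim: Mochizuki2012, status: disputed] -/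
def frameSat : CandMochizuki6.Saturation S := fun j vQ U => (P.frame j vQ).hull U

/-- `frameSat` is extensive (`U ⊆ hull U`). [folklore] -/
theorem frameSat_extensive : CandMochizuki6.Extensive S (frameSat S P) := fun j vQ U => (P.frame j vQ).subset_hull U

/-- The hull of the union of the possible images absorbs the hull of each possible image (monotonicity of the hull). [folklore] -/
theorem frameSat_hullAbsorbs : CandMochizuki6.HullAbsorbs S P (frameSat S P) := fun _ vQ _ hU =>
  (P.frame _ vQ).hull_mono (Set.subset_sUnion_of_mem hU)

/-- **RP-M36a sharpened: with the FAITHFUL saturation the mechanism clause `H` holds in EVERY setting** — «the hull absorbs the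
indeterminacy» is a theorem of the frame axioms, not a constraint. [folklore] -/
theorem H_frameSat : CandMochizuki6.H S P (frameSat S P) := ⟨frameSat_extensive S P, frameSat_hullAbsorbs S P⟩

/-- With the faithful saturation, `H'` says exactly: at every label of `𝔽_l^⋇` the q-pilot's Kummer region lies in the hull of SOME possible
image (the comparison clause alone). [folklore] -/
theorem H'_frameSat_iff : CandMochizuki6.H' S P ρ qK (frameSat S P) ↔
    ∀ (i : Fin T.lstar) (vQ : T.VQ), ∃ U ∈ P.possibleImages (Setting.labelSucc i) vQ,
      ρ qK (Setting.labelSucc i) vQ ⊆ (P.frame _ vQ).hull U :=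
  ⟨fun h => h.2, fun h => ⟨H_frameSat S P, h⟩⟩

/-! ## 2. SAT+[frame]: the four hull/volume-level rows hold at `flipSetting p` -/

section Frame

open PinnedWitness PinnedHonest NaiveWitness Cor312.Checks Cor312.IdentifiedNonVacuity

variable (p : ℕ) [Fact p.Prime]

/-- At `flipSetting p` the q-pilot's Kummer region lies in the hull at every label of `𝔽_l^⋇` (w4-d103's `flip_gapH3` unfolded under the
pins). [folklore] -/
theorem flip_rho_subset_thetaHull (i : Fin Cor312.Checks.toyIndex.lstar) (vQ : Cor312.Checks.toyIndex.VQ) :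
    orbitRegion p (qDatum p) (Setting.labelSucc i) vQ ⊆ (flipSetting p).thetaHull (Setting.labelSucc i) vQ :=
  (gapH3_iff _ _ _ _).1 (flip_gapH3 p) (flip_pinnedRegions3 p) i vQ

/-- **RP-M04b at the frame locus**: `CandMochizuki4.H'` HOLDS at `flipSetting p`. [folklore] -/
theorem M04b_at_flipSetting : CandMochizuki4.H' (naiveFull p).toLatticeSituation (flipSetting p) (orbitRegion p) (qDatum p) :=
  fun _ => flip_rho_subset_thetaHull p

/-- **RP-M36b at the frame locus** with the FAITHFUL saturation: `CandMochizuki6.H' frameSat` HOLDS at `flipSetting p` (the hull of the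
single possible image `B_{j²}` is the coarse hull-set `B_1 ⊇ B_1 = ρ(qDatum)`). [folklore] -/
theorem M36b_at_flipSetting :
    CandMochizuki6.H' (naiveFull p).toLatticeSituation (flipSetting p) (orbitRegion p) (qDatum p)
      (frameSat (naiveFull p).toLatticeSituation (flipSetting p)) := by
  refine (H'_frameSat_iff _ _ _ _).2 fun i vQ => ⟨_, (flipSetting p).thetaRegion3_mem_possibleImages _ vQ, ?_⟩
  refine (flip_rho_subset_thetaHull p i vQ).trans (le_of_eq ?_)
  show ((flipSetting p).frame _ vQ).hull (⋃₀ (flipSetting p).possibleImages _ vQ) = ((flipSetting p).frame _ vQ).hull _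
  rw [flip_sUnion_possibleImages, flip_thetaRegion3]

/-- **RP-M36c at the frame locus**: READING 0 (`CandMochizuki6.H''`) HOLDS at `flipSetting p`. [folklore] -/
theorem M36c_at_flipSetting : CandMochizuki6.H'' (naiveFull p).toLatticeSituation (flipSetting p) :=
  CandMochizuki6.H''_of_rho_subset_thetaHull _ _ (orbitRegion p) (qDatum p) (flip_bridgeHyps p) (flip_pinnedRegions3 p).1.2
    (flip_rho_subset_thetaHull p)

/-- **RP-M36d at the frame locus**: `CandMochizuki6.H'''` HOLDS at `flipSetting p` (`−|log(Θ)| = −|log(q)|`). [folklore] -/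
theorem M36d_at_flipSetting : CandMochizuki6.H''' (naiveFull p).toLatticeSituation (flipSetting p) := (flip_statement p).2

omit [Fact p.Prime] in
/-- **SAT+[frame], packaged at `p = 2`**: typed Thm. 3.11 ∧ `BridgeHyps` ∧ `|log(q)| > 0` ∧ `PinnedRegions3` ∧ `¬GapA3` (honest volumes: the
region-level residual fails) ∧ RP-M04b ∧ RP-M36b (faithful saturation) ∧ RP-M36c ∧ RP-M36d ∧ Statement, all at abc-iut-w4-d103's
`flipSetting 2` — inflation locus «frame». [claim: Mochizuki2012, status: disputed] -/
theorem frame_locus_witnesses :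
    ∃ (T : ThetaIndex) (F : FullSituation T) (P : Cor312.Setting F.toLatticeSituation.toSituation)
      (ρ : (∀ v : T.V, v ∈ T.Vbad → Set (F.L.StarPacket v)) → ∀ (j : T.Label) (vQ : T.VQ), Set (F.L.Packet j vQ))
      (qK : ∀ v : T.V, v ∈ T.Vbad → Set (F.L.StarPacket v)),
      F.Statement ∧ BridgeHyps P ∧ P.AbsLogQPos ∧ PinnedRegions3 F.toLatticeSituation P ρ qK ∧ ¬ GapA3 F.toLatticeSituation P ρ qK ∧
        CandMochizuki4.H' F.toLatticeSituation P ρ qK ∧ CandMochizuki6.H' F.toLatticeSituation P ρ qK (frameSat F.toLatticeSituation P) ∧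
        CandMochizuki6.H'' F.toLatticeSituation P ∧ CandMochizuki6.H''' F.toLatticeSituation P ∧ P.Statement := by
  haveI : Fact (Nat.Prime 2) := ⟨Nat.prime_two⟩
  exact ⟨Cor312.Checks.toyIndex, naiveFull 2, flipSetting 2, orbitRegion 2, qDatum 2, naiveFull_statement 2, flip_bridgeHyps 2,
    flip_absLogQPos 2, flip_pinnedRegions3 2, flip_not_gapA3 2, M04b_at_flipSetting 2, M36b_at_flipSetting 2, M36c_at_flipSetting 2,
    M36d_at_flipSetting 2, flip_statement 2⟩

end Frame

end Summit.ABC.IUTFork.Repair.CandMochizuki6Tests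

end
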